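import Mathlib
import HarnessLib
import Literature.MathematicalPhysics.KineticTheory.HardSphereEulerProofs
import Literature.MathematicalPhysics.KineticTheory.HardSphereTwoTimePressure
import Literature.Analysis.FluidPDE.HardSphereFlowJointMeasurable
import Summits.AtomisticToContinuum.HydrodynamicLimit.Theses.OneFlightGossipEngine
import Summits.AtomisticToContinuum.HydrodynamicLimit.Theorems.OneFlightGossipEngineKineticCurrentsWindowLDUniformJensenTimeSum
import Summits.AtomisticToContinuum.HydrodynamicLimit.Theorems.OneFlightGossipEngineKineticCurrentsWindowLDUniformFibreExpMoment
import Summits.AtomisticToContinuum.HydrodynamicLimit.Theorems.OneFlightGossipEngineKineticCurrentsWindowLDApriori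

/-!
# Window tails from the single-time window transfer — stub `stub_windowTails_of_transfer` of
# line `Sketch`, crux `KineticCurrentsLDAlongFamilies` (stmt-AtomisticToContinuum-16659)

Route `OneFlightGossipEngine`, sub-problem `HydrodynamicLimit`, stub S4 of the skeleton
`Cruxes/KineticCurrentsLDAlongFamilies/Lines/Sketch.lean`. Along a jointly continuous positive
profile family `s ∈ [0, t₁]` (`0 < σ ≤ 1/2`), IF the local Gibbs laws
`λ_s = localGibbsLaw σ (a s) (u₀ s) (θ₀ s) N (Φ N)` satisfy the single-time window transfer
(conclusion of stub S3, taken here as the antecedent: `∫ g∘Φ_r dλ_s ≤ e^{δ(N+1)} (∫ g^q dλ_s)^{1/q}`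
for measurable `g ≥ 0`, some `q ≥ 1`, thresholds uniform in `s ∈ [0, t₁]` and `r` in the kinetic
window `[0, w]`, `w = τ(N+1)^{-1/3}`), THEN the window-averaged velocity tails
`∑ᵢ w⁻¹∫₀ʷ max 0 (‖vᵢ(r)‖² − V) dr` have exponential moments `≤ e^{κ(N+1)}` at every rate
`γ ∈ [0, γ₀]`, for every `κ > 0`, once the level `V = V(κ)` is large, uniformly in `s ∈ [0, t₁]`.

Proof: (1) Jensen in time (`KineticCurrentsWindowLDUniformSketch.stub_jensenTimeSum`, the flow is
jointly measurable on its conull good set, `HardSphereFlow.measurable_flow_prod_torus`) reduces to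
single-time moments `∫ exp (∑ᵢ γ max 0 (‖vᵢ‖² − V)) ∘ Φ_r dλ_s`; (2) the transfer at time `r` with
`δ = κ/2` reduces to the static moment `(∫ ∏ᵢ e^{qγ max 0 (‖vᵢ‖² − V)} dλ_s)^{1/q}`; (3) given the
positions the velocities are independent Gaussians
(`KineticCurrentsWindowLDUniformSketch.stub_fibreExpMoment`), and the one-body Gaussian tail
`∫ e^{qγ max 0 (‖v‖² − V)} M_{1,θ,u}(v) dv ≤ 1 + e^{-cV} e^{2cU²} (1 − 4cΘ)^{-3/2}` (`qγ ≤ c`,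
`θ ≤ Θ`, `‖u‖ ≤ U`, `16cΘ = 1`; `lintegral_exp_mul_norm_sq_gaussMeasure_le`) is `≤ e^{qκ/2}`
for `V` large; `Θ, U` bound the family on the compact `[0, t₁] × 𝕋³`.

References: H. Spohn, *Large Scale Dynamics of Interacting Particles* (1991), Part I §2.3 (local
equilibrium states); S. Olla, S. R. S. Varadhan, H.-T. Yau, Comm. Math. Phys. 155 (1993) §2.
-/

noncomputable section

open MeasureTheory Set Filter
open scoped ENNReal Topology

namespace Summit.AtomisticToContinuum.HydrodynamicLimit.Theorems.KineticCurrentsLDAlongFamiliesSketch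

open Literature.Analysis.FluidPDE (HardSphereFlow Config localMaxwellian canonicalDensity liouville)
open Literature.MathematicalPhysics.KineticTheory (T3 V3 hsDiameter localGibbsLaw localGibbsMeasure
  localGibbsProfile)
open Literature.Analysis.FluidPDE Literature.MathematicalPhysics.KineticTheory

/-- A jointly continuous real family `f` on `[0, t₁] × 𝕋³` is bounded above by some `M ≥ 1`
(continuity on the compact set `Icc 0 t₁ ×ˢ univ`; `𝕋³` is a compact space). [folklore] -/
private theorem wtl_exists_upper_bound (t₁ : ℝ) (f : ℝ → T3 → ℝ)
    (hf : Continuous (Function.uncurry f)) :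
    ∃ M : ℝ, 1 ≤ M ∧ ∀ s ∈ Icc 0 t₁, ∀ x, f s x ≤ M := by
  have hK : IsCompact (Icc (0 : ℝ) t₁ ×ˢ (univ : Set T3)) := isCompact_Icc.prod isCompact_univ
  obtain ⟨C, hC⟩ := hK.exists_bound_of_continuousOn hf.continuousOn
  refine ⟨max 1 C, le_max_left _ _, fun s hs x => ?_⟩
  have hmem : (s, x) ∈ Icc (0 : ℝ) t₁ ×ˢ (univ : Set T3) := Set.mk_mem_prod hs (mem_univ _)
  exact ((Real.le_norm_self _).trans (hC (s, x) hmem)).trans (le_max_right _ _)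

/-- Pointwise tail bound: for `b ≤ c`, `exp (b · max 0 (t − V)) ≤ 1 + exp (c (t − V))`
(the left side is `1` if `t ≤ V` and `≤ exp (c (t − V))` otherwise). [folklore] -/
private theorem wtl_exp_mul_max_le {b c : ℝ} (hbc : b ≤ c) (t V : ℝ) :
    Real.exp (b * max 0 (t - V)) ≤ 1 + Real.exp (c * (t - V)) := by
  rcases le_total (t - V) 0 with h | h
  · rw [max_eq_left h, mul_zero, Real.exp_zero]
    exact le_add_of_nonneg_right (Real.exp_nonneg _)
  · rw [max_eq_right h]
    exact (Real.exp_le_exp.2 (mul_le_mul_of_nonneg_right hbc h)).trans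
      (le_add_of_nonneg_left zero_le_one)

/-- **One-body Gaussian tail.** For `0 < θ ≤ Θ`, `‖u‖ ≤ U`, `0 ≤ c` with `4cΘ < 1` and a rate
`b ≤ c`: `∫ exp (b · max 0 (‖v‖² − V)) M_{1,θ,u}(v) dv ≤ 1 + e^{-cV} e^{2cU²} (1 − 4cΘ)^{-3/2}`
(pointwise `exp (b max 0 (‖v‖² − V)) ≤ 1 + e^{-cV} e^{c‖v‖²}`, unit mass of the Maxwellian, and the
Gaussian exponential moment `lintegral_exp_mul_norm_sq_gaussMeasure_le` monotone in `(θ, ‖u‖)`).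
[folklore] -/
private theorem wtl_fibre_tail_le {θ Θ U c b : ℝ} (hθ : 0 < θ) (hθΘ : θ ≤ Θ) (u : V3)
    (hu : ‖u‖ ≤ U) (hc : 0 ≤ c) (hcΘ : 2 * (2 * c) * Θ < 1) (hbc : b ≤ c) (V : ℝ) :
    ∫⁻ v, ENNReal.ofReal (Real.exp (b * max 0 (‖v‖ ^ 2 - V))) *
        ENNReal.ofReal (localMaxwellian 1 θ u v) ≤
      ENNReal.ofReal (1 + Real.exp (-(c * V)) *
        (Real.exp (2 * c * U ^ 2) * (1 - 2 * (2 * c) * Θ) ^ (-(3 : ℝ) / 2))) := by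
  set g : V3 → ℝ≥0∞ := fun v => ENNReal.ofReal (Real.exp (b * max 0 (‖v‖ ^ 2 - V))) with hgdef
  have hgm : Measurable g :=
    (Real.measurable_exp.comp ((measurable_const.max
      ((measurable_id.norm.pow_const 2).sub_const V)).const_mul b)).ennreal_ofReal
  have hM : Measurable fun v : V3 => ENNReal.ofReal (localMaxwellian 1 θ u v) :=
    (continuous_localMaxwellian 1 θ u).measurable.ennreal_ofReal
  -- the tilt factor `B v = exp (2c · ‖v‖²/2) = exp (c ‖v‖²)` and the constant `A = e^{-cV}`
  set A : ℝ≥0∞ := ENNReal.ofReal (Real.exp (-(c * V))) with hAdef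
  set B : V3 → ℝ≥0∞ := fun v => ENNReal.ofReal (Real.exp (2 * c * (‖v‖ ^ 2 / 2))) with hBdef
  have hBm : Measurable B := by
    rw [hBdef]
    fun_prop
  -- pointwise bound in `ℝ≥0∞`
  have hpt : ∀ v, g v ≤ 1 + A * B v := by
    intro v
    have h1 := wtl_exp_mul_max_le hbc (‖v‖ ^ 2) V
    have h2 : Real.exp (c * (‖v‖ ^ 2 - V)) =
        Real.exp (-(c * V)) * Real.exp (2 * c * (‖v‖ ^ 2 / 2)) := by
      rw [← Real.exp_add]
      congr 1
      ring
    calc g v ≤ ENNReal.ofReal (1 + Real.exp (c * (‖v‖ ^ 2 - V))) := ENNReal.ofReal_le_ofReal h1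
      _ = 1 + A * B v := by
          rw [ENNReal.ofReal_add zero_le_one (Real.exp_nonneg _), ENNReal.ofReal_one, h2,
            ENNReal.ofReal_mul (Real.exp_nonneg _)]
  -- integrate against the Gaussian `M_{1,θ,u} dv = gaussMeasure u θ`
  have hθ4 : 2 * (2 * c) * θ < 1 := by nlinarith
  have hgauss : ∫⁻ v, B v ∂gaussMeasure u θ ≤
      ENNReal.ofReal (Real.exp (2 * c * U ^ 2) * (1 - 2 * (2 * c) * Θ) ^ (-(3 : ℝ) / 2)) := by
    refine (lintegral_exp_mul_norm_sq_gaussMeasure_le hθ (by positivity) hθ4 u).trans ?_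
    refine ENNReal.ofReal_le_ofReal ?_
    have h := gaussMgfConst_mono (d := 3) (by positivity : (0 : ℝ) ≤ 2 * c) (by norm_num) hθΘ hcΘ
      (norm_nonneg u) hu
    simpa [finrank_euclideanSpace_fin] using h
  calc ∫⁻ v, g v * ENNReal.ofReal (localMaxwellian 1 θ u v)
      = ∫⁻ v, g v ∂gaussMeasure u θ := by
        rw [← withDensity_localMaxwellian_eq_gaussMeasure hθ u,
          lintegral_withDensity_eq_lintegral_mul _ hM hgm]
        exact lintegral_congr fun v => mul_comm _ _
    _ ≤ ∫⁻ v, 1 + A * B v ∂gaussMeasure u θ := lintegral_mono hpt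
    _ = 1 + A * ∫⁻ v, B v ∂gaussMeasure u θ := by
        rw [lintegral_add_left measurable_const, lintegral_const, measure_univ, mul_one,
          lintegral_const_mul _ hBm]
    _ ≤ 1 + A * ENNReal.ofReal (Real.exp (2 * c * U ^ 2) * (1 - 2 * (2 * c) * Θ) ^ (-(3 : ℝ) / 2)) :=
        add_le_add le_rfl (mul_le_mul' le_rfl hgauss)
    _ = _ := by
        rw [hAdef, ← ENNReal.ofReal_mul (Real.exp_nonneg _), ← ENNReal.ofReal_one,
          ← ENNReal.ofReal_add zero_le_one (by
            have : 0 < 1 - 2 * (2 * c) * Θ := by linarith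
            positivity)]

/-- **S4 — window tails from the single-time window transfer** (stub `stub_windowTails_of_transfer`
of line `Sketch`, crux `KineticCurrentsLDAlongFamilies`, stmt-AtomisticToContinuum-16659). If along a
jointly continuous positive profile family on `[0, t₁] × 𝕋³` (`0 < σ ≤ 1/2`) the local Gibbs laws
`λ_s` satisfy the single-time window transfer `∫ g∘Φ_r dλ_s ≤ e^{δ(N+1)} (∫ g^q dλ_s)^{1/q}`
(`g ≥ 0` measurable, some `q ≥ 1`, thresholds uniform in `s ∈ [0, t₁]` and `r ∈ [0, τ(N+1)^{-1/3}]`),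
then for every flow family there is `γ₀ > 0` such that for `0 ≤ γ ≤ γ₀` and every `κ > 0` some
level `V ≥ 1` makes `∫ exp (γ ∑ᵢ w⁻¹∫₀ʷ max 0 (‖vᵢ(r)‖² − V) dr) dλ_s ≤ e^{κ(N+1)}` for every
`τ > 0`, `N ≥ N₀(τ)`, `s ∈ [0, t₁]` (Jensen in time, transfer at each `r` with `δ = κ/2`, static
Gaussian fibre tails). [folklore] -/
theorem stub_windowTails_of_transfer :
    (∀ (t₁ : ℝ) (a θ₀ : ℝ → T3 → ℝ) (u₀ : ℝ → T3 → V3),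
      Continuous (Function.uncurry a) → Continuous (Function.uncurry θ₀) →
      Continuous (Function.uncurry u₀) → (∀ s x, 0 < a s x) → (∀ s x, 0 < θ₀ s x) →
      ∀ σ : ℝ, 0 < σ → σ ≤ 1 / 2 →
      ∃ q : ℝ, 1 ≤ q ∧ ∀ τ : ℝ, 0 < τ → ∀ δ : ℝ, 0 < δ →
      ∀ Φ : (N : ℕ) →
        HardSphereFlow (Literature.Analysis.FluidPDE.Torus.geometry (Fin 3)) (hsDiameter σ N) (N + 1),
      ∃ N₀ : ℕ, ∀ N : ℕ, N₀ ≤ N → ∀ s ∈ Icc 0 t₁,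
      ∀ r ∈ Icc (0 : ℝ) (τ * ((N : ℝ) + 1) ^ (-(1 / 3 : ℝ))),
      ∀ g : Config (N + 1) (Fin 3) T3 → ℝ≥0∞, Measurable g →
        ∫⁻ z, g ((Φ N).flow r z) ∂(localGibbsLaw σ (a s) (u₀ s) (θ₀ s) N (Φ N)) ≤
          ENNReal.ofReal (Real.exp (δ * ((N : ℝ) + 1))) *
            (∫⁻ z, g z ^ q ∂(localGibbsLaw σ (a s) (u₀ s) (θ₀ s) N (Φ N))) ^ (1 / q)) →
    ∀ (t₁ : ℝ) (a θ₀ : ℝ → T3 → ℝ) (u₀ : ℝ → T3 → V3),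
    Continuous (Function.uncurry a) → Continuous (Function.uncurry θ₀) →
    Continuous (Function.uncurry u₀) → (∀ s x, 0 < a s x) → (∀ s x, 0 < θ₀ s x) →
    ∀ σ : ℝ, 0 < σ → σ ≤ 1 / 2 →
    ∀ Φ : (N : ℕ) →
      HardSphereFlow (Literature.Analysis.FluidPDE.Torus.geometry (Fin 3)) (hsDiameter σ N) (N + 1),
    ∃ γ₀ : ℝ, 0 < γ₀ ∧ ∀ γ : ℝ, 0 ≤ γ → γ ≤ γ₀ → ∀ κ : ℝ, 0 < κ → ∃ V : ℝ, 1 ≤ V ∧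
    ∀ τ : ℝ, 0 < τ → ∃ N₀ : ℕ, ∀ N : ℕ, N₀ ≤ N → ∀ s ∈ Icc 0 t₁,
      ∫⁻ z, ENNReal.ofReal (Real.exp (γ * ∑ i : Fin (N + 1),
          (τ * ((N : ℝ) + 1) ^ (-(1 / 3 : ℝ)))⁻¹ *
            ∫ r in (0 : ℝ)..(τ * ((N : ℝ) + 1) ^ (-(1 / 3 : ℝ))),
              max 0 (‖(((Φ N).flow r z) i).2‖ ^ 2 - V)))
        ∂(localGibbsLaw σ (a s) (u₀ s) (θ₀ s) N (Φ N)) ≤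
      ENNReal.ofReal (Real.exp (κ * ((N : ℝ) + 1))) := by
  intro hWT t₁ a θ₀ u₀ ha hθ hu ha0 hθ0 σ hσ hσ2 Φ
  -- the transfer exponent `q ≥ 1`
  obtain ⟨q, hq1, hT⟩ := hWT t₁ a θ₀ u₀ ha hθ hu ha0 hθ0 σ hσ hσ2
  have hq0 : 0 < q := one_pos.trans_le hq1
  -- bounds of the family on `[0, t₁] × 𝕋³`
  obtain ⟨Θ, hΘ1, hΘ⟩ := wtl_exists_upper_bound t₁ θ₀ hθ
  obtain ⟨U, hU1, hU⟩ := wtl_exists_upper_bound t₁ (fun s x => ‖u₀ s x‖) hu.norm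
  have hΘ0 : 0 < Θ := one_pos.trans_le hΘ1
  -- the one-body rate `c = q γ₀` with `16 c Θ = 1`, and the Gaussian constant `A₀`
  set c : ℝ := 1 / (16 * Θ) with hcdef
  have hc0 : 0 < c := by positivity
  have hcΘ : 2 * (2 * c) * Θ < 1 := by
    have h16 : c * (16 * Θ) = 1 := by rw [hcdef]; field_simp
    nlinarith
  set A₀ : ℝ := Real.exp (2 * c * U ^ 2) * (1 - 2 * (2 * c) * Θ) ^ (-(3 : ℝ) / 2) with hA₀def
  have hA₀0 : 0 < A₀ := by
    have : 0 < 1 - 2 * (2 * c) * Θ := by linarith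
    positivity
  refine ⟨c / q, by positivity, fun γ hγ0 hγ1 κ hκ => ?_⟩
  have hqγc : q * γ ≤ c := by rwa [le_div_iff₀ hq0, mul_comm] at hγ1
  -- the level `V`: `A₀ e^{-cV} ≤ qκ/2`
  obtain ⟨V, hV1, hV⟩ : ∃ V : ℝ, 1 ≤ V ∧ A₀ * Real.exp (-(c * V)) ≤ q * κ / 2 := by
    refine ⟨max 1 (Real.log (2 * A₀ / (q * κ)) / c), le_max_left _ _, ?_⟩
    have hcV : Real.log (2 * A₀ / (q * κ)) ≤ c * max 1 (Real.log (2 * A₀ / (q * κ)) / c) := by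
      rw [mul_comm c, ← div_le_iff₀ hc0]
      exact le_max_right _ _
    have hA := hA₀0.ne'
    have hq := hq0.ne'
    have hk := hκ.ne'
    calc A₀ * Real.exp (-(c * max 1 (Real.log (2 * A₀ / (q * κ)) / c)))
        ≤ A₀ * Real.exp (-Real.log (2 * A₀ / (q * κ))) :=
          mul_le_mul_of_nonneg_left (Real.exp_le_exp.2 (neg_le_neg hcV)) hA₀0.le
      _ = A₀ * (2 * A₀ / (q * κ))⁻¹ := by rw [Real.exp_neg, Real.exp_log (by positivity)]
      _ = q * κ / 2 := by field_simp
  refine ⟨V, hV1, fun τ hτ => ?_⟩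
  -- the transfer threshold at `δ = κ/2`
  obtain ⟨N₀, hN₀⟩ := hT τ hτ (κ / 2) (half_pos hκ) Φ
  refine ⟨N₀, fun N hN s hs => ?_⟩
  -- fixed `N`, `s`: window, slice profiles, law, good set
  set w : ℝ := τ * ((N : ℝ) + 1) ^ (-(1 / 3 : ℝ)) with hwdef
  have hw : 0 < w := by positivity
  have has : Continuous (a s) := ha.uncurry_left s
  have hθs : Continuous (θ₀ s) := hθ.uncurry_left s
  have hus : Continuous (u₀ s) := hu.uncurry_left s
  set P := localGibbsLaw σ (a s) (u₀ s) (θ₀ s) N (Φ N) with hPdef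
  have hPgood : P (Φ N).goodᶜ = 0 :=
    localGibbsLaw_absolutelyContinuous σ (a s) (u₀ s) (θ₀ s) N (Φ N) (Φ N).measure_compl_good
  -- Step 1: the exponent is a window sum of the non-negative `Yᵢ z = γ max 0 (‖(z i).2‖² − V)`
  have hrw : ∀ z : Config (N + 1) (Fin 3) T3,
      γ * ∑ i : Fin (N + 1), w⁻¹ * ∫ r in (0 : ℝ)..w,
          max 0 (‖(((Φ N).flow r z) i).2‖ ^ 2 - V) =
        ∑ i : Fin (N + 1), w⁻¹ * ∫ r in (0 : ℝ)..w,
          γ * max 0 (‖(((Φ N).flow r z) i).2‖ ^ 2 - V) := by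
    intro z
    rw [Finset.mul_sum]
    refine Finset.sum_congr rfl fun i _ => ?_
    rw [intervalIntegral.integral_const_mul]
    ring
  simp_rw [hrw]
  have hYm : ∀ i : Fin (N + 1), Measurable fun z : Config (N + 1) (Fin 3) T3 =>
      γ * max 0 (‖(z i).2‖ ^ 2 - V) := fun i =>
    (measurable_const.max ((((measurable_pi_apply i).snd).norm.pow_const 2).sub_const V)).const_mul γ
  have hY0 : ∀ (i : Fin (N + 1)) (z : Config (N + 1) (Fin 3) T3),
      0 ≤ γ * max 0 (‖(z i).2‖ ^ 2 - V) := fun i z => mul_nonneg hγ0 (le_max_left _ _)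
  -- Step 2: Jensen in time
  have hJ := KineticCurrentsWindowLDUniformSketch.stub_jensenTimeSum (Config (N + 1) (Fin 3) T3) P
    (Φ N).good (Φ N).measurableSet_good hPgood (Φ N).flow (Φ N).measurable_flow_prod_torus (N + 1)
    (fun i z => γ * max 0 (‖(z i).2‖ ^ 2 - V)) hYm hY0 w hw
  refine hJ.trans (iSup₂_le fun r hr => ?_)
  -- Step 3: the window transfer at time `r`
  set Gf : Config (N + 1) (Fin 3) T3 → ℝ≥0∞ :=
    fun z => ENNReal.ofReal (Real.exp (∑ i, γ * max 0 (‖(z i).2‖ ^ 2 - V))) with hGfdef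
  have hGm : Measurable Gf :=
    (Real.measurable_exp.comp (Finset.measurable_sum _ fun i _ => hYm i)).ennreal_ofReal
  have hTr := hN₀ N hN s hs r hr Gf hGm
  refine hTr.trans ?_
  -- the `q`-th power is a product of one-body factors
  set g : T3 × V3 → ℝ≥0∞ :=
    fun y => ENNReal.ofReal (Real.exp (q * γ * max 0 (‖y.2‖ ^ 2 - V))) with hgdef
  have hgm : Measurable g :=
    (Real.measurable_exp.comp ((measurable_const.max
      ((measurable_snd.norm.pow_const 2).sub_const V)).const_mul _)).ennreal_ofReal
  have hGq : ∀ z, Gf z ^ q = ∏ i, g (z i) := by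
    intro z
    simp only [hGfdef, hgdef]
    rw [ENNReal.ofReal_rpow_of_nonneg (Real.exp_pos _).le hq0.le, ← Real.exp_mul, Finset.sum_mul,
      Real.exp_sum, ENNReal.ofReal_prod_of_nonneg fun i _ => (Real.exp_pos _).le]
    refine Finset.prod_congr rfl fun i _ => ?_
    congr 2
    ring
  simp_rw [hGq]
  -- Step 4: static fibre moments, `K = 1 + η`, `η = e^{-cV} A₀ ≤ qκ/2`
  set η : ℝ := Real.exp (-(c * V)) * A₀ with hηdef
  have hη0 : 0 ≤ η := by positivity
  have hηle : η ≤ q * κ / 2 := by rw [hηdef, mul_comm]; exact hV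
  set K : ℝ≥0∞ := ENNReal.ofReal (1 + η) with hKdef
  have hfib : ∫⁻ z, ∏ i, g (z i) ∂P ≤ K ^ (N + 1) := by
    rw [hPdef, localGibbsLaw_eq]
    refine KineticCurrentsWindowLDUniformSketch.stub_fibreExpMoment (a s) (θ₀ s) (u₀ s) has hθs hus
      (ha0 s) (hθ0 s) σ hσ hσ2 N g hgm K fun x => ?_
    exact wtl_fibre_tail_le (hθ0 s x) (hΘ s hs x) (u₀ s x) (hU s hs x) hc0.le hcΘ hqγc V
  have hKle : K ^ (N + 1) ≤ ENNReal.ofReal (Real.exp (((N : ℝ) + 1) * η)) := by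
    rw [hKdef, ← ENNReal.ofReal_pow (by positivity)]
    refine ENNReal.ofReal_le_ofReal ?_
    have h1 : (1 + η) ^ (N + 1) ≤ Real.exp η ^ (N + 1) :=
      pow_le_pow_left₀ (by positivity) (by linarith [Real.add_one_le_exp η]) _
    refine h1.trans_eq ?_
    rw [← Real.exp_nat_mul]
    push_cast
    ring_nf
  have hroot : (∫⁻ z, ∏ i, g (z i) ∂P) ^ (1 / q) ≤
      ENNReal.ofReal (Real.exp (κ / 2 * ((N : ℝ) + 1))) := by
    refine (ENNReal.rpow_le_rpow (hfib.trans hKle) (by positivity)).trans ?_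
    rw [ENNReal.ofReal_rpow_of_nonneg (Real.exp_pos _).le (by positivity), ← Real.exp_mul]
    refine ENNReal.ofReal_le_ofReal (Real.exp_le_exp.2 ?_)
    have h1 : η * (1 / q) ≤ κ / 2 := by
      rw [mul_one_div, div_le_iff₀ hq0]
      linarith
    calc ((N : ℝ) + 1) * η * (1 / q) = ((N : ℝ) + 1) * (η * (1 / q)) := by ring
      _ ≤ ((N : ℝ) + 1) * (κ / 2) := mul_le_mul_of_nonneg_left h1 (by positivity)
      _ = κ / 2 * ((N : ℝ) + 1) := by ring
  -- Step 5: combine `e^{κ(N+1)/2} · e^{κ(N+1)/2} = e^{κ(N+1)}`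
  refine (mul_le_mul' le_rfl hroot).trans_eq ?_
  rw [← ENNReal.ofReal_mul (Real.exp_pos _).le, ← Real.exp_add]
  congr 2
  ring

end Summit.AtomisticToContinuum.HydrodynamicLimit.Theorems.KineticCurrentsLDAlongFamiliesSketch

end
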